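/-
Copyright (c) 2026 the pub-hodgecm-mathlib formalisation cell (harness21).  Prover seat hodgecm-mathlib-K2E1-p09 (g6), Track B ∕ K2-LIT, h413 =
`stmt-HodgeConjecture-24833`, ENGINE E1, campaign «EIS-R7-BL-SPH-3» (the `N = 3` clone), RE-ASSIGN (b1)₃ of the dealer K2E1-plan (g5) 2026-09-04T09:35:51Z.
-/
import Summits.HodgeConjecture.HodgeConjecture.Theorems.K2E1BLEisensteinMemHXCMTwo        -- ★ p858951 (K2E4-p23 g0) (b1) N = 2: the RANK-GENERIC packaging `norm_toHX_le_of_norm_le_mul_supHeight_pow`; brings ★ `memLp_two_withDensity_supHeight_of_norm_le_mul_pow`, `supHeight_eq_ciSup_arithmetic`, `measurable_quotFun_of_measurable`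
import Summits.HodgeConjecture.HodgeConjecture.Theorems.K2E1BLHeckeOperatorHXU2           -- ★ p858962 (this seat): RANK-GENERIC `measurable_supHeight`
import Summits.HodgeConjecture.HodgeConjecture.Theorems.K2E1BorelEisensteinRegularCMThree  -- ★ `continuous_eisensteinSeriesU_flatSectionU_cm_three` (`2 < Re z`)
import Summits.HodgeConjecture.HodgeConjecture.Theorems.K2E1BLReductionCoveringU3          -- ★ p858884 (K2E1-p02 g6) BL-R1₃: `exists_pos_forall_lt_ciSup_borelHeight_mul_cm_three` (`c₀ < w₁`)
import Summits.HodgeConjecture.HodgeConjecture.Theorems.K2E1EisensteinCompactRangeMajorantCMThree  -- ★ p859036 (K2-defs1 g6) (ED. 2): the letter `hmod` = `norm_eisensteinSeriesU_flatSectionU_le_uniform_cm_three`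
import HarnessLib

/-!
# K2·E1 — `K2E1BLEisensteinMemHXCMThree` ((b1)₃, «EIS-R7-BL-SPH-3»): `E(φ₀H^z) ∈ 𝓗_k(𝔛)` ON `U(2,1)_{L∕L⁺}` FOR `2 < σ₁ ≤ Re z ≤ k`, WITH THE `𝓗_k(𝔛)`-NORM BOUNDED
# UNIFORMLY — HYPOTHESIS-FIRST ON THE SINGLE LETTER `hmod` (the `N = 3` uniform majorant `‖E(φ₀H^z)(g)‖ ≤ ‖φ₀‖·C·w₁(g)^k`)

Track B ∕ K2-LIT, crux h413 = `stmt-HodgeConjecture-24833`, route of record `HCCMUnconditional`; cell `hodgecm-mathlib`, squad K2, ENGINE E1 (campaign «EIS-R7-BL», the BL-SPH-3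
clone; (ζ′) WIRING 7d1cceb628a30de8 §3 P7 ∕ §4; dealer 09:35:51Z: «N = 3 twin of ★ p858951 … HYPOTHESIS-FIRST on the single letter `hmod` := K2-defs1 (g6)'s §4 head
`norm_eisensteinSeriesU_flatSectionU_le_uniform_cm_three`; everything else BY NAME»).  Prover seat `hodgecm-mathlib-K2E1-p09` (g6).  THEOREMS ONLY (no `def`, no `instance`, no
notation, no named-fact hypothesis, no `sorry`; default heartbeats); lane `--supports stmt-HodgeConjecture-24833 --as helper` (count-neutral).  Closes no socket.

THE MATHEMATICS [BernsteinLapid2019, §4 (p. 10), §7; MoeglinWaldspurger1995, I.2.13, II.1.5, IV.1.8].  On `U(2,1)_{L∕L⁺}` (`2ρ_B = 2`, Godement region `Re z > 2`) the spherical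
Borel Eisenstein series has MODERATE GROWTH in the reduction-theory weight `w₁(g) = ⨆_{γ ∈ G(F)} H(γ·g)`: uniformly on `σ₁ ≤ Re z ≤ k` (`2 < σ₁`),
`‖E(φ₀H^z)(g)‖ ≤ ‖φ₀‖·C·w₁(g)^k` — the LETTER `hmod` of this file (K2-defs1 (g6)'s §4 head, the `N = 3` twin of ★ `norm_eisensteinSeriesU_flatSectionU_le_uniform_cm_two`, specialised at
`σ₂ := k`; an ED. 2 `obtain`s it when ★).  Since `w₁(x̃⁻¹) = supHeight x` on `𝔛` (★ `supHeight_eq_ciSup_arithmetic`, rank-generic), `w₁ ≥ c₀ > 0` (§1, from ★ BL-R1₃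
`exists_pos_forall_lt_ciSup_borelHeight_mul_cm_three`), `w₁` is Borel (★ `measurable_supHeight`, rank-generic) and `quotFun E(φ₀H^z)` is Borel (§2: `E` continuous for `Re z > 2` ★,
left-`G(F)`-invariant ★, ★ `measurable_quotFun_of_measurable`), the RANK-GENERIC packaging of ★ (b1) gives: **`quotFun E(φ₀H^z) ∈ L²(𝔛, w₁^{−2k}dμ) = 𝓗_k(𝔛)`** for every finite Borel
`μ` on `𝔛`, and **ONE constant with `‖toHX k μ E(φ₀H^z)‖ ≤ C'` for all `σ₁ ≤ Re z ≤ k`** — the domination input of (b2)₃ (holomorphy of `z ↦ ι E(φ₀H^z)` in `𝓗_k(Z_c)`).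

* §1 `exists_pos_forall_le_supHeight_cm_three` (`c₀ ≤ w₁` on `𝔛`, N = 3).   §2 `measurable_quotFun_eisensteinSeriesU_cm_three` (`2 < Re z`).
* §3 **`eisensteinSeriesU_flatSectionU_memHX_cm_three_of_majorant`**, **`norm_toHX_eisensteinSeriesU_le_uniform_cm_three_of_majorant`** (HEAD, letter `hmod`).
HONEST LABEL: HC_CM is proved only modulo the 7 printed citations (2 remaining named inputs: hLiu418 = `stmt-HodgeConjecture-24832`, h413 = `stmt-HodgeConjecture-24833`) until rung 0
closes; this file asserts no named fact and closes no socket; count-neutral.  CONDITIONAL BY CONSTRUCTION on `hmod` (payer: K2-defs1 (g6) §4 `…_le_uniform_cm_three`).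

## References
* [BernsteinLapid2019] J. Bernstein, E. Lapid, *On the meromorphic continuation of Eisenstein series*, J. Amer. Math. Soc. 37 (2024) (arXiv:1911.02342): §4 p. 10, §7.
* [MoeglinWaldspurger1995] C. Mœglin, J.-L. Waldspurger, *Spectral Decomposition and Eisenstein Series* (1995): I.2.13, II.1.5, IV.1.8.
-/

set_option autoImplicit false
set_option linter.dupNamespace false  -- the mandated namespace repeats the summit's segment (`HodgeConjecture.HodgeConjecture`)

noncomputable section

open MeasureTheory Measure NumberField IsDedekindDomain Set Filter
open scoped ENNReal NNReal Topology
open Literature.NumberTheory.Automorphic Literature.NumberTheory.Automorphic.UnitaryGroup AdelicGroupData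
open Summit.HodgeConjecture.HodgeConjecture.Cruxes.H413.K2E1BorelEisensteinU
open Summit.HodgeConjecture.HodgeConjecture.Cruxes.H413.K2E1BLEisensteinInWeightedSpaceU2Weights (memLp_two_withDensity_supHeight_of_norm_le_mul_pow supHeight_eq_ciSup_arithmetic)
open Summit.HodgeConjecture.HodgeConjecture.Cruxes.H413.K2E1BLEisensteinMemHXCMTwo (norm_toHX_le_of_norm_le_mul_supHeight_pow)
open Summit.HodgeConjecture.HodgeConjecture.Cruxes.H413.K2E1BLHeckeOperatorHXU2 (measurable_supHeight)
open Summit.HodgeConjecture.HodgeConjecture.Cruxes.H413.K2E1TruncatedEisensteinL2 (measurable_quotFun_of_measurable)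
open Summit.HodgeConjecture.HodgeConjecture.Cruxes.H413.K2E1BorelEisensteinRegularCMThree (continuous_eisensteinSeriesU_flatSectionU_cm_three)
open Summit.HodgeConjecture.HodgeConjecture.Cruxes.H413.K2E1BLReductionCoveringU3 (exists_pos_forall_lt_ciSup_borelHeight_mul_cm_three)

namespace Summit.HodgeConjecture.HodgeConjecture.Cruxes.H413.K2E1BLEisensteinMemHXCMThree

variable (L : Type) [Field L] [NumberField L] [IsCMField L]

/-! ## §1 The floor `c₀ ≤ w₁` on `𝔛` at `N = 3` -/

/-- **`c₀ ≤ w₁` AT THE CM PAIR, `N = 3`**: there is `c₀ > 0` with `c₀ ≤ supHeight x` for every `x ∈ 𝔛` (★ BL-R1₃ `exists_pos_forall_lt_ciSup_borelHeight_mul_cm_three` at the representative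
`x̃⁻¹`, ★ `supHeight_eq_ciSup_arithmetic`); the `N = 3` twin of ★ `exists_pos_forall_le_supHeight_cm`. [cite: BernsteinLapid2019, §4 p. 10] -/
theorem exists_pos_forall_le_supHeight_cm_three :
    ∃ c₀ : ℝ≥0, 0 < c₀ ∧ ∀ x : (quasiSplit (↥(maximalRealSubfield L)) L (IsCMField.complexConj L) 3).automorphicQuotient,
      c₀ ≤ K2E1BLBorelSpacesU2Defs.supHeight (↥(maximalRealSubfield L)) L (IsCMField.complexConj L) 3 x := by
  obtain ⟨c₀, hc₀, h⟩ := exists_pos_forall_lt_ciSup_borelHeight_mul_cm_three L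
  refine ⟨c₀, hc₀, fun x => ?_⟩
  rw [supHeight_eq_ciSup_arithmetic]
  exact (h _).le

/-! ## §2 `quotFun E(φ₀H^z)` is Borel for `2 < Re z` -/

variable [MeasurableSpace (quasiSplit (↥(maximalRealSubfield L)) L (IsCMField.complexConj L) 3).Adelic] [BorelSpace (quasiSplit (↥(maximalRealSubfield L)) L (IsCMField.complexConj L) 3).Adelic]

/-- `E(φ₀H^z)` (`Re z > 2`) is continuous (★ `continuous_eisensteinSeriesU_flatSectionU_cm_three`) and left-`G(F)`-invariant (★ `eisensteinSeriesU_flatSectionU_rational_mul`), so its descent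
`quotFun` to `𝔛` is Borel (★ `measurable_quotFun_of_measurable`); the `N = 3` twin of ★ `measurable_quotFun_eisensteinSeriesU_cm_two`. [cite: MoeglinWaldspurger1995, I.2.13, II.1.5] -/
theorem measurable_quotFun_eisensteinSeriesU_cm_three (φ₀ : ℂ) {z : ℂ} (hz : 2 < z.re) :
    Measurable ((quasiSplit (↥(maximalRealSubfield L)) L (IsCMField.complexConj L) 3).quotFun
      (eisensteinSeriesU (flatSectionU (fun _ : (quasiSplit (↥(maximalRealSubfield L)) L (IsCMField.complexConj L) 3).Adelic => φ₀) z))) := by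
  have hEc := continuous_eisensteinSeriesU_flatSectionU_cm_three L hz (φ := fun _ : (quasiSplit (↥(maximalRealSubfield L)) L (IsCMField.complexConj L) 3).Adelic => φ₀)
    continuous_const (M := ‖φ₀‖) (fun _ => le_rfl)
  refine measurable_quotFun_of_measurable hEc.measurable fun γ x => ?_
  obtain ⟨γ', hγ'⟩ := MonoidHom.mem_range.1 γ.2
  rw [← hγ']
  exact eisensteinSeriesU_flatSectionU_rational_mul (φ := fun _ : (quasiSplit (↥(maximalRealSubfield L)) L (IsCMField.complexConj L) 3).Adelic => φ₀) (fun _ _ _ => rfl) z γ' x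

/-! ## §3 Membership in `𝓗_k(𝔛)` and the uniform norm bound, HYPOTHESIS-FIRST on the letter `hmod` -/

/-- **(b1)₃ `E(φ₀H^z) ∈ 𝓗_k(𝔛)` FOR `2 < σ₁ ≤ Re z ≤ k`, modulo the letter `hmod`** (the uniform majorant `‖E(φ₀H^z)(g)‖ ≤ ‖φ₀‖·C·w₁(g)^k` on `σ₁ ≤ Re z ≤ k` — K2-defs1 (g6)'s §4 head at
`σ₂ := k`): for every finite Borel measure `μ` on `𝔛`, `quotFun E(φ₀H^z) ∈ L²(𝔛, w₁^{−2k}dμ)` (★ `memLp_two_withDensity_supHeight_of_norm_le_mul_pow` with ★ `measurable_supHeight`, §1, §2 and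
`hmod` at `g = x̃⁻¹`, `w₁(x̃⁻¹) = supHeight x` ★ `supHeight_eq_ciSup_arithmetic`). [cite: BernsteinLapid2019, §4 (p. 10), §7] [cite: MoeglinWaldspurger1995, II.1.5, IV.1.8] -/
theorem eisensteinSeriesU_flatSectionU_memHX_cm_three_of_majorant (μ : Measure (quasiSplit (↥(maximalRealSubfield L)) L (IsCMField.complexConj L) 3).automorphicQuotient)
    [IsFiniteMeasure μ] (φ₀ : ℂ) (k : ℕ) {σ₁ : ℝ} (h2 : 2 < σ₁)
    (hmod : ∃ C : ℝ, 0 ≤ C ∧ ∀ z : ℂ, σ₁ ≤ z.re → z.re ≤ k → ∀ g : (quasiSplit (↥(maximalRealSubfield L)) L (IsCMField.complexConj L) 3).Adelic,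
      ‖eisensteinSeriesU (flatSectionU (fun _ : (quasiSplit (↥(maximalRealSubfield L)) L (IsCMField.complexConj L) 3).Adelic => φ₀) z) g‖ ≤ ‖φ₀‖ * C *
        (((⨆ γ : (quasiSplit (↥(maximalRealSubfield L)) L (IsCMField.complexConj L) 3).arithmeticSubgroup,
          borelHeight ((γ : (quasiSplit (↥(maximalRealSubfield L)) L (IsCMField.complexConj L) 3).Adelic) * g)) : ℝ≥0) : ℝ) ^ (k : ℝ))
    {z : ℂ} (hz : σ₁ ≤ z.re) (hzk : z.re ≤ k) :
    MemLp ((quasiSplit (↥(maximalRealSubfield L)) L (IsCMField.complexConj L) 3).quotFun (eisensteinSeriesU (flatSectionU (fun _ : (quasiSplit (↥(maximalRealSubfield L)) L (IsCMField.complexConj L) 3).Adelic => φ₀) z))) 2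
      (μ.withDensity fun x => (((K2E1BLBorelSpacesU2Defs.supHeight (↥(maximalRealSubfield L)) L (IsCMField.complexConj L) 3 x)⁻¹ ^ (2 * k) : ℝ≥0) : ℝ≥0∞)) := by
  obtain ⟨C, hC, hmaj⟩ := hmod
  obtain ⟨c₀, hc₀, hwc⟩ := exists_pos_forall_le_supHeight_cm_three L
  refine memLp_two_withDensity_supHeight_of_norm_le_mul_pow measurable_supHeight hc₀ hwc
    (measurable_quotFun_eisensteinSeriesU_cm_three L φ₀ (h2.trans_le hz)).aestronglyMeasurable (C := ‖φ₀‖ * C) (n := k) (fun x => ?_) le_rfl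
  rw [supHeight_eq_ciSup_arithmetic, ← Real.rpow_natCast]
  exact hmaj z hz hzk (Quotient.out (x : (quasiSplit (↥(maximalRealSubfield L)) L (IsCMField.complexConj L) 3).Adelic ⧸ (quasiSplit (↥(maximalRealSubfield L)) L (IsCMField.complexConj L) 3).quotientSubgroup))⁻¹

/-- **THE `𝓗_k(𝔛)`-NORM OF `E(φ₀H^z)` IS BOUNDED UNIFORMLY ON `{σ₁ ≤ Re z ≤ k}`** (`2 < σ₁ ≤ k`), modulo `hmod`: ONE constant `C'` with `‖toHX k μ E(φ₀H^z)‖ ≤ C'` for all such `z`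
(`hmod` + ★ `norm_toHX_le_of_norm_le_mul_supHeight_pow`).  The HEAD of (b1)₃ — the domination input of (b2)₃.  [cite: BernsteinLapid2019, §4 (p. 10), §7] [cite: MoeglinWaldspurger1995, IV.1.8] -/
theorem norm_toHX_eisensteinSeriesU_le_uniform_cm_three_of_majorant (μ : Measure (quasiSplit (↥(maximalRealSubfield L)) L (IsCMField.complexConj L) 3).automorphicQuotient)
    [IsFiniteMeasure μ] (φ₀ : ℂ) (k : ℕ) {σ₁ : ℝ} (h2 : 2 < σ₁)
    (hmod : ∃ C : ℝ, 0 ≤ C ∧ ∀ z : ℂ, σ₁ ≤ z.re → z.re ≤ k → ∀ g : (quasiSplit (↥(maximalRealSubfield L)) L (IsCMField.complexConj L) 3).Adelic,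
      ‖eisensteinSeriesU (flatSectionU (fun _ : (quasiSplit (↥(maximalRealSubfield L)) L (IsCMField.complexConj L) 3).Adelic => φ₀) z) g‖ ≤ ‖φ₀‖ * C *
        (((⨆ γ : (quasiSplit (↥(maximalRealSubfield L)) L (IsCMField.complexConj L) 3).arithmeticSubgroup,
          borelHeight ((γ : (quasiSplit (↥(maximalRealSubfield L)) L (IsCMField.complexConj L) 3).Adelic) * g)) : ℝ≥0) : ℝ) ^ (k : ℝ)) :
    ∃ C' : ℝ, 0 ≤ C' ∧ ∀ z : ℂ, ∀ hz : σ₁ ≤ z.re, ∀ hzk : z.re ≤ k,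
      ‖K2E1BLBorelSpacesU2Defs.toHX (↥(maximalRealSubfield L)) L (IsCMField.complexConj L) 3 k μ
          (eisensteinSeriesU (flatSectionU (fun _ : (quasiSplit (↥(maximalRealSubfield L)) L (IsCMField.complexConj L) 3).Adelic => φ₀) z))
          (eisensteinSeriesU_flatSectionU_memHX_cm_three_of_majorant L μ φ₀ k h2 hmod hz hzk)‖ ≤ C' := by
  obtain ⟨C, hC, hmaj⟩ := hmod
  obtain ⟨c₀, hc₀, hwc⟩ := exists_pos_forall_le_supHeight_cm_three L
  refine ⟨‖φ₀‖ * C * ((μ univ) ^ (1 / 2 : ℝ)).toReal, by positivity, fun z hz hzk => ?_⟩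
  refine norm_toHX_le_of_norm_le_mul_supHeight_pow measurable_supHeight hc₀ hwc _ (mul_nonneg (norm_nonneg _) hC) fun x => ?_
  rw [supHeight_eq_ciSup_arithmetic, ← Real.rpow_natCast]
  exact hmaj z hz hzk (Quotient.out (x : (quasiSplit (↥(maximalRealSubfield L)) L (IsCMField.complexConj L) 3).Adelic ⧸ (quasiSplit (↥(maximalRealSubfield L)) L (IsCMField.complexConj L) 3).quotientSubgroup))⁻¹

/-! ## §4 (ED. 2) The letter `hmod` DISCHARGED: ★ `norm_eisensteinSeriesU_flatSectionU_le_uniform_cm_three` (K2-defs1 (g6), p859036)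

The uniform majorant `‖E(φ₀H^z)(g)‖ ≤ ‖φ₀‖·C·w₁(g)^{σ₂}` on `{σ₁ ≤ Re z ≤ σ₂}` (`2 < σ₁`) is ★; instantiated at `σ₂ := k` it is literally the letter `hmod` of §3.  The remaining
inputs `(ν, 𝓕)` (a Haar measure on `N(𝔸)` and a relatively compact fundamental domain of `N(F)∖N(𝔸)`) are CHOICES feeding the ★ cusp bound, not hypotheses on `E` — exactly as
in the `N = 2` twin ★ `K2E1BLEisensteinMemHXCMTwo.norm_toHX_eisensteinSeriesU_le_uniform_cm_two`. -/

/-- **(b1)₃ `E(φ₀H^z) ∈ 𝓗_k(𝔛)` FOR `2 < Re z ≤ k` ON `U(2,1)_{L∕L⁺}`, LETTER-FREE**: for every finite Borel measure `μ` on `𝔛`, `quotFun E(φ₀H^z) ∈ L²(𝔛, w₁^{−2k}dμ)` — §3 with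
`hmod` := ★ `norm_eisensteinSeriesU_flatSectionU_le_uniform_cm_three` on the window `[Re z, k]`. [cite: BernsteinLapid2019, §4 (p. 10), §7] [cite: MoeglinWaldspurger1995, II.1.5, IV.1.8] -/
theorem eisensteinSeriesU_flatSectionU_memHX_cm_three
    (ν : Measure ↥(adelicUnipotent (↥(maximalRealSubfield L)) L (IsCMField.complexConj L) 3)) [ν.IsHaarMeasure] {𝓕 : Set ↥(adelicUnipotent (↥(maximalRealSubfield L)) L (IsCMField.complexConj L) 3)}
    (h𝓕N : IsFundamentalDomain ↥(rationalUnipotent (↥(maximalRealSubfield L)) L (IsCMField.complexConj L) 3) 𝓕 ν) (h𝓕c : IsCompact (closure 𝓕))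
    (μ : Measure (quasiSplit (↥(maximalRealSubfield L)) L (IsCMField.complexConj L) 3).automorphicQuotient) [IsFiniteMeasure μ] (φ₀ : ℂ) (k : ℕ) {z : ℂ} (hz : 2 < z.re) (hzk : z.re ≤ k) :
    MemLp ((quasiSplit (↥(maximalRealSubfield L)) L (IsCMField.complexConj L) 3).quotFun (eisensteinSeriesU (flatSectionU (fun _ : (quasiSplit (↥(maximalRealSubfield L)) L (IsCMField.complexConj L) 3).Adelic => φ₀) z))) 2
      (μ.withDensity fun x => (((K2E1BLBorelSpacesU2Defs.supHeight (↥(maximalRealSubfield L)) L (IsCMField.complexConj L) 3 x)⁻¹ ^ (2 * k) : ℝ≥0) : ℝ≥0∞)) :=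
  eisensteinSeriesU_flatSectionU_memHX_cm_three_of_majorant L μ φ₀ k hz
    (K2E1EisensteinCompactRangeMajorantCMThree.norm_eisensteinSeriesU_flatSectionU_le_uniform_cm_three L ν h𝓕N h𝓕c φ₀ hz (σ₂ := (k : ℝ))) le_rfl hzk

/-- **THE `𝓗_k(𝔛)`-NORM OF `E(φ₀H^z)` IS BOUNDED UNIFORMLY ON `{σ₁ ≤ Re z ≤ k}`, LETTER-FREE** (`2 < σ₁`; the HEAD of (b1)₃ and the domination input of (b2)₃): ONE constant `C`
with `‖toHX k μ E(φ₀H^z)‖ ≤ C` for all `z` with `σ₁ ≤ Re z ≤ k` — §3 with `hmod` := ★ `norm_eisensteinSeriesU_flatSectionU_le_uniform_cm_three` at `σ₂ := k`.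
[cite: BernsteinLapid2019, §4 (p. 10), §7] [cite: MoeglinWaldspurger1995, IV.1.8] -/
theorem norm_toHX_eisensteinSeriesU_le_uniform_cm_three
    (ν : Measure ↥(adelicUnipotent (↥(maximalRealSubfield L)) L (IsCMField.complexConj L) 3)) [ν.IsHaarMeasure] {𝓕 : Set ↥(adelicUnipotent (↥(maximalRealSubfield L)) L (IsCMField.complexConj L) 3)}
    (h𝓕N : IsFundamentalDomain ↥(rationalUnipotent (↥(maximalRealSubfield L)) L (IsCMField.complexConj L) 3) 𝓕 ν) (h𝓕c : IsCompact (closure 𝓕))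
    (μ : Measure (quasiSplit (↥(maximalRealSubfield L)) L (IsCMField.complexConj L) 3).automorphicQuotient) [IsFiniteMeasure μ] (φ₀ : ℂ) (k : ℕ) {σ₁ : ℝ} (h2 : 2 < σ₁) :
    ∃ C : ℝ, 0 ≤ C ∧ ∀ z : ℂ, ∀ hz : σ₁ ≤ z.re, ∀ hzk : z.re ≤ k,
      ‖K2E1BLBorelSpacesU2Defs.toHX (↥(maximalRealSubfield L)) L (IsCMField.complexConj L) 3 k μ
          (eisensteinSeriesU (flatSectionU (fun _ : (quasiSplit (↥(maximalRealSubfield L)) L (IsCMField.complexConj L) 3).Adelic => φ₀) z))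
          (eisensteinSeriesU_flatSectionU_memHX_cm_three L ν h𝓕N h𝓕c μ φ₀ k (h2.trans_le hz) hzk)‖ ≤ C := by
  obtain ⟨C, hC, h⟩ := norm_toHX_eisensteinSeriesU_le_uniform_cm_three_of_majorant L μ φ₀ k h2
    (K2E1EisensteinCompactRangeMajorantCMThree.norm_eisensteinSeriesU_flatSectionU_le_uniform_cm_three L ν h𝓕N h𝓕c φ₀ h2 (σ₂ := (k : ℝ)))
  exact ⟨C, hC, fun z hz hzk => h z hz hzk⟩

/-- **THE DEALER'S WINDOW FORM** (`2 < σ₁`, `σ₂ ≤ k`): ONE constant `C` with `‖toHX k μ E(φ₀H^z)‖ ≤ C` for all `z` with `σ₁ ≤ Re z ≤ σ₂` (the previous theorem restricted to the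
sub-window; membership is `eisensteinSeriesU_flatSectionU_memHX_cm_three`). [cite: BernsteinLapid2019, §4 (p. 10), §7] [cite: MoeglinWaldspurger1995, IV.1.8] -/
theorem norm_toHX_eisensteinSeriesU_le_uniform_cm_three_window
    (ν : Measure ↥(adelicUnipotent (↥(maximalRealSubfield L)) L (IsCMField.complexConj L) 3)) [ν.IsHaarMeasure] {𝓕 : Set ↥(adelicUnipotent (↥(maximalRealSubfield L)) L (IsCMField.complexConj L) 3)}
    (h𝓕N : IsFundamentalDomain ↥(rationalUnipotent (↥(maximalRealSubfield L)) L (IsCMField.complexConj L) 3) 𝓕 ν) (h𝓕c : IsCompact (closure 𝓕))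
    (μ : Measure (quasiSplit (↥(maximalRealSubfield L)) L (IsCMField.complexConj L) 3).automorphicQuotient) [IsFiniteMeasure μ] (φ₀ : ℂ) (k : ℕ) {σ₁ σ₂ : ℝ} (h2 : 2 < σ₁) (hk : σ₂ ≤ k) :
    ∃ C : ℝ, 0 ≤ C ∧ ∀ z : ℂ, ∀ hz : σ₁ ≤ z.re, ∀ hz₂ : z.re ≤ σ₂,
      ‖K2E1BLBorelSpacesU2Defs.toHX (↥(maximalRealSubfield L)) L (IsCMField.complexConj L) 3 k μ
          (eisensteinSeriesU (flatSectionU (fun _ : (quasiSplit (↥(maximalRealSubfield L)) L (IsCMField.complexConj L) 3).Adelic => φ₀) z))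
          (eisensteinSeriesU_flatSectionU_memHX_cm_three L ν h𝓕N h𝓕c μ φ₀ k (h2.trans_le hz) (hz₂.trans hk))‖ ≤ C := by
  obtain ⟨C, hC, h⟩ := norm_toHX_eisensteinSeriesU_le_uniform_cm_three L ν h𝓕N h𝓕c μ φ₀ k h2
  exact ⟨C, hC, fun z hz hz₂ => h z hz (hz₂.trans hk)⟩

end Summit.HodgeConjecture.HodgeConjecture.Cruxes.H413.K2E1BLEisensteinMemHXCMThree

end
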